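import Summits.QuantumFields.YangMills.Theorems.ColdStartUniversalityLatticeLangevinDoeblinSZZ
import HarnessLib

/-!
# Route `ColdStartUniversality` (fixed-cut-off package, `β' = 0`): SMOOTHING BY BROWNIAN MOTION ON `SU(2)^E` INSIDE THE RIDGE
# CLASS — `κ⁰_s` maps ridge functions to ridge functions, and ridge functions are `C³` compactly supported cylinder functions

Helper file (seat `ym-line-csu-p1`, g18; `--supports stmt-QuantumFields-27363`).  A ridge function is a finite sum
`R = Σ_l c_l ∏_e U_{m_{l,e}}(⟨ρ g_{l,e}, ρ V_e⟩/2)` of products of latitude eigenfunctions (Chebyshev `U_m = gegenbauerSum 1 m`).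

* `exists_contDiff_cylinder_eq_ridge` — every ridge function is `f ∘ coords` with `f` `C³` of compact support on the ambient
  coordinate space (polynomial ∘ linear, cut off by a bump `≡ 1` near the group) — the test class of the tree's generator-form
  Poincaré inequality / `tendsto_dirichletForm_semigroup`.
* `transition_ridge_beta_zero` — for ANY realising kernel family `κ⁰` of the `β' = 0` dynamics,
  `κ⁰_s R = Σ_l c_l e^{−s Σ_e m_{l,e}(m_{l,e}+2)/2} ∏_e U_{m_{l,e}}(…)` (`integral_prod_gegenbauer_latitude` through `hreal`):
  THE HEAT SEMIGROUP PRESERVES THE RIDGE CLASS.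
* ★ `exists_ridge_near_and_cylinder_transition` — for continuous `G`, `δ > 0`, `s ≥ 0`: a ridge `R` with `|R − G| < δ` and a `C³`
  compactly supported `f` with `f ∘ coords = κ⁰_s R` (`exists_ridge_uniform_near` + the two items above).  This is the
  smoothing step of «generator-form Poincaré ⇒ decay» done INSIDE an explicit eigenfunction class, replacing hypoelliptic
  smoothing `(S)` of `…WilsonSemigroupPoincareSmoothing`.

THEOREMS ONLY, no definition, no sorry.  HONEST FRAMING: RECORD-rung R3 plumbing at FIXED cut-off; nothing K-uniform is proved;
no crux, rung or summit statement is proved; the Yang–Mills mass gap is NOT proved.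
-/

set_option autoImplicit false

noncomputable section

namespace Summit.QuantumFields.YangMills.Theorems.ColdStartUniversality

open MeasureTheory ProbabilityTheory Filter Set Topology Finset
open scoped BigOperators NNReal ENNReal
open Literature.Probability.Process Literature.MathematicalPhysics.QuantumFieldTheory
open Literature.MathematicalPhysics.QuantumLattice (fundamentalRep fundamentalLatticeRep continuous_fundamentalRep)
open Literature.Analysis.SpecialFunctions (gegenbauerSum)

variable {L : ℕ} [NeZero L]

/-- **Ridge functions are `C³` compactly supported cylinder functions**: for every finite ridge datum `(c, g, m)` there is a
`C³` `f` of compact support on the real link-coordinate space with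
`f (coords V) = Σ_l c_l ∏_e U_{m_{l,e}}(⟨ρ g_{l,e}, ρ V_e⟩/2)` for all `V ∈ SU(2)^E` (bump `≡ 1` on the ball of radius `2 ⊇ coords(SU(2)^E)`
times polynomial ∘ linear). [folklore] -/
theorem exists_contDiff_cylinder_eq_ridge {ι : Type} [Fintype ι] (c : ι → ℝ)
    (g : ι → Edge 3 L → Matrix.specialUnitaryGroup (Fin 2) ℂ) (m : ι → Edge 3 L → ℕ) :
    ∃ f : (Edge 3 L × Fin 2 × Fin 2 × Bool → ℝ) → ℝ, ContDiff ℝ 3 f ∧ HasCompactSupport f ∧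
      ∀ V : GaugeConfig 3 L (Matrix.specialUnitaryGroup (Fin 2) ℂ),
        f (fun q => (fun z : ℂ => if q.2.2.2 then z.im else z.re)
            ((fundamentalRep (Fin 2) (V q.1) : Matrix (Fin 2) (Fin 2) ℂ) q.2.1 q.2.2.1)) =
          ∑ l, c l * ∏ e, gegenbauerSum 1 (m l e)
            (hsForm 2 (fundamentalRep (Fin 2) (g l e)) (fundamentalRep (Fin 2) (V e)) / 2) := by
  classical
  -- the latitudes as continuous linear maps of the ambient coordinates
  choose ℓ hℓ using fun l : ι =>
    latitude_eq_clm (L := L) (fun e => (fundamentalRep (Fin 2) (g l e) : Matrix (Fin 2) (Fin 2) ℂ))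
  let χ : ContDiffBump (0 : (Edge 3 L × Fin 2 × Fin 2 × Bool) → ℝ) := ⟨2, 3, by norm_num, by norm_num⟩
  set f₀ : ((Edge 3 L × Fin 2 × Fin 2 × Bool) → ℝ) → ℝ := fun y =>
    ∑ l, c l * ∏ e, gegenbauerSum 1 (m l e) (ℓ l y e) with hf₀
  set f : ((Edge 3 L × Fin 2 × Fin 2 × Bool) → ℝ) → ℝ := fun y =>
    (χ : ((Edge 3 L × Fin 2 × Fin 2 × Bool) → ℝ) → ℝ) y * f₀ y with hf
  have hf₀s : ContDiff ℝ 3 f₀ := by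
    refine ContDiff.sum fun l _ => contDiff_const.mul ?_
    exact contDiff_prod fun e _ => (contDiff_gegenbauerSum 1 (m l e)).comp ((contDiff_apply ℝ ℝ e).comp (ℓ l).contDiff)
  refine ⟨f, (χ.contDiff (n := 3)).mul hf₀s, χ.hasCompactSupport.mul_right, fun V => ?_⟩
  set y : (Edge 3 L × Fin 2 × Fin 2 × Bool) → ℝ := fun q => (fun z : ℂ => if q.2.2.2 then z.im else z.re)
    ((fundamentalRep (Fin 2) (V q.1) : Matrix (Fin 2) (Fin 2) ℂ) q.2.1 q.2.2.1) with hy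
  have hball : y ∈ Metric.closedBall (0 : (Edge 3 L × Fin 2 × Fin 2 × Bool) → ℝ) 2 := by
    rw [Metric.mem_closedBall, dist_zero_right]
    have h1 := norm_coords_le_one (L := L) V
    refine le_trans (le_of_eq ?_) (h1.trans (by norm_num))
    congr 1
  have hχ1 : (χ : ((Edge 3 L × Fin 2 × Fin 2 × Bool) → ℝ) → ℝ) y = 1 := χ.one_of_mem_closedBall hball
  have hlat : ∀ l e, ℓ l y e = hsForm 2 (fundamentalRep (Fin 2) (g l e)) (fundamentalRep (Fin 2) (V e)) / 2 := by
    intro l e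
    rw [hℓ l y e]
    exact latitude_coords (L := L) (fun e => (fundamentalRep (Fin 2) (g l e) : Matrix (Fin 2) (Fin 2) ℂ))
      (fun e => (fundamentalRep (Fin 2) (V e) : Matrix (Fin 2) (Fin 2) ℂ)) e
  show (χ : ((Edge 3 L × Fin 2 × Fin 2 × Bool) → ℝ) → ℝ) y * f₀ y = _
  rw [hχ1, one_mul, hf₀]
  simp_rw [hlat]

/-- **The heat semigroup on `SU(2)^E` preserves the ridge class**: for any realising kernel family `κ⁰` of the `β' = 0` SZZ
dynamics (Brownian motion on `SU(2)^E`) and every ridge datum,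
`∫ (Σ_l c_l ∏_e U_{m_{l,e}}(⟨ρ g_{l,e}, ρ y_e⟩/2)) κ⁰_s(V, dy) = Σ_l c_l e^{−s Σ_e m_{l,e}(m_{l,e}+2)/2} ∏_e U_{m_{l,e}}(⟨ρ g_{l,e}, ρ V_e⟩/2)`
(`integral_prod_gegenbauer_latitude` on the regular flow of the product Wiener space, transported by `hreal`). [folklore] -/
theorem transition_ridge_beta_zero (L : ℕ) [NeZero L]
    (κ₀ : ℝ≥0 → Kernel (GaugeConfig 3 L (Matrix.specialUnitaryGroup (Fin 2) ℂ))
      (GaugeConfig 3 L (Matrix.specialUnitaryGroup (Fin 2) ℂ))) [∀ t, IsMarkovKernel (κ₀ t)]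
    (hreal₀ : ∀ (t : ℝ≥0) (x : GaugeConfig 3 L (Matrix.specialUnitaryGroup (Fin 2) ℂ))
        (Ω : Type) [MeasurableSpace Ω] (P : Measure Ω) [IsProbabilityMeasure P]
        (W : ℝ≥0 → Ω → (Edge 3 L × NoiseIdx 2 → ℝ)) (hW : IsFlatBrownian W P)
        (U : ℝ≥0 → Ω → GaugeConfig 3 L (Matrix.specialUnitaryGroup (Fin 2) ℂ)),
        (∀ ω, U 0 ω = x) →
        (latticeLangevinDynamics (fundamentalLatticeRep 2) 0).IsSolution (fundamentalRep (Fin 2))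
          hW.natFiltration P W U →
        κ₀ t x = P.map (U t))
    {ι : Type} [Fintype ι] (c : ι → ℝ) (g : ι → Edge 3 L → Matrix.specialUnitaryGroup (Fin 2) ℂ) (m : ι → Edge 3 L → ℕ)
    (s : ℝ≥0) (V : GaugeConfig 3 L (Matrix.specialUnitaryGroup (Fin 2) ℂ)) :
    ∫ y, (∑ l, c l * ∏ e, gegenbauerSum 1 (m l e)
        (hsForm 2 (fundamentalRep (Fin 2) (g l e)) (fundamentalRep (Fin 2) (y e)) / 2)) ∂(κ₀ s V) =
      ∑ l, (c l * Real.exp (-(∑ e, (m l e : ℝ) * ((m l e : ℝ) + 2) / 2) * s)) *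
        ∏ e, gegenbauerSum 1 (m l e) (hsForm 2 (fundamentalRep (Fin 2) (g l e)) (fundamentalRep (Fin 2) (V e)) / 2) := by
  classical
  haveI := secondCountableTopology_su2
  haveI := borelSpace_config L
  haveI := isProbabilityMeasure_piWiener (Edge 3 L × NoiseIdx 2)
  have hWc := isFlatBrownian_piWiener 3 L (NoiseIdx 2)
  obtain ⟨Y, GY, hY, hYm, -, -, -⟩ := exists_regularFlow L 0 hWc
  have hκ₀ : κ₀ s V = (Measure.pi fun _ : Edge 3 L × NoiseIdx 2 => preWienerMeasure).map (Y V s) :=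
    hreal₀ s V _ _ _ hWc (Y V) (hY V).1 (hY V).2
  have hmY : Measurable (Y V s) := ((hY V).2.adapted s).mono (hWc.natFiltration.le s) le_rfl
  have hRc : Continuous fun y : GaugeConfig 3 L (Matrix.specialUnitaryGroup (Fin 2) ℂ) =>
      ∑ l, c l * ∏ e, gegenbauerSum 1 (m l e) (hsForm 2 (fundamentalRep (Fin 2) (g l e)) (fundamentalRep (Fin 2) (y e)) / 2) :=
    continuous_finsetSum _ fun l _ => continuous_const.mul (continuous_prod_gegenbauer_latitude (L := L) (g l) (m l))
  rw [hκ₀, integral_map hmY.aemeasurable hRc.aestronglyMeasurable]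
  -- integrability of each latitude product along the flow
  have hint : ∀ l, Integrable (fun ω => ∏ e, gegenbauerSum 1 (m l e)
      (hsForm 2 (fundamentalRep (Fin 2) (g l e)) (fundamentalRep (Fin 2) (Y V s ω e)) / 2))
      (Measure.pi fun _ : Edge 3 L × NoiseIdx 2 => preWienerMeasure) := by
    intro l
    have hc := continuous_prod_gegenbauer_latitude (L := L) (g l) (m l)
    obtain ⟨M, -, hM⟩ := exists_abs_le_of_continuous hc
    exact Integrable.of_bound ((hc.measurable.comp hmY).aestronglyMeasurable) M
      (Eventually.of_forall fun ω => by rw [Real.norm_eq_abs]; exact hM _)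
  rw [integral_finsetSum _ fun l _ => (hint l).const_mul (c l)]
  refine Finset.sum_congr rfl fun l _ => ?_
  rw [integral_const_mul, integral_prod_gegenbauer_latitude hWc Y hY hYm V (g l) (m l) s, mul_assoc]

/-- ★ **Smoothing inside the ridge class.**  For any realising kernel family `κ⁰` of the `β' = 0` dynamics, every continuous `G`,
`δ > 0` and `s ≥ 0` there are a continuous (ridge) `R` with `|R − G| < δ` everywhere and a `C³` compactly supported `f` on the
ambient coordinate space with `f (coords V) = ∫ R dκ⁰_s(V, ·)` for all `V`: uniform density of ridge functions
(`exists_ridge_uniform_near`, Stone–Weierstrass), invariance of the ridge class under the heat semigroup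
(`transition_ridge_beta_zero`) and `exists_contDiff_cylinder_eq_ridge`. [folklore] -/
theorem exists_ridge_near_and_cylinder_transition (L : ℕ) [NeZero L]
    (κ₀ : ℝ≥0 → Kernel (GaugeConfig 3 L (Matrix.specialUnitaryGroup (Fin 2) ℂ))
      (GaugeConfig 3 L (Matrix.specialUnitaryGroup (Fin 2) ℂ))) [∀ t, IsMarkovKernel (κ₀ t)]
    (hreal₀ : ∀ (t : ℝ≥0) (x : GaugeConfig 3 L (Matrix.specialUnitaryGroup (Fin 2) ℂ))
        (Ω : Type) [MeasurableSpace Ω] (P : Measure Ω) [IsProbabilityMeasure P]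
        (W : ℝ≥0 → Ω → (Edge 3 L × NoiseIdx 2 → ℝ)) (hW : IsFlatBrownian W P)
        (U : ℝ≥0 → Ω → GaugeConfig 3 L (Matrix.specialUnitaryGroup (Fin 2) ℂ)),
        (∀ ω, U 0 ω = x) →
        (latticeLangevinDynamics (fundamentalLatticeRep 2) 0).IsSolution (fundamentalRep (Fin 2))
          hW.natFiltration P W U →
        κ₀ t x = P.map (U t))
    {G : GaugeConfig 3 L (Matrix.specialUnitaryGroup (Fin 2) ℂ) → ℝ} (hG : Continuous G) {δ : ℝ} (hδ : 0 < δ) (s : ℝ≥0) :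
    ∃ R : GaugeConfig 3 L (Matrix.specialUnitaryGroup (Fin 2) ℂ) → ℝ, Continuous R ∧ (∀ V, |R V - G V| < δ) ∧
      ∃ f : (Edge 3 L × Fin 2 × Fin 2 × Bool → ℝ) → ℝ, ContDiff ℝ 3 f ∧ HasCompactSupport f ∧
        ∀ V : GaugeConfig 3 L (Matrix.specialUnitaryGroup (Fin 2) ℂ),
          f (fun q => (fun z : ℂ => if q.2.2.2 then z.im else z.re)
              ((fundamentalRep (Fin 2) (V q.1) : Matrix (Fin 2) (Fin 2) ℂ) q.2.1 q.2.2.1)) = ∫ y, R y ∂(κ₀ s V) := by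
  classical
  obtain ⟨ι, hι, c, g, m, hR⟩ := exists_ridge_uniform_near (L := L) hG hδ
  refine ⟨fun V => ∑ l, c l * ∏ e, gegenbauerSum 1 (m l e)
      (hsForm 2 (fundamentalRep (Fin 2) (g l e)) (fundamentalRep (Fin 2) (V e)) / 2),
    continuous_finsetSum _ fun l _ => continuous_const.mul (continuous_prod_gegenbauer_latitude (L := L) (g l) (m l)),
    hR, ?_⟩
  obtain ⟨f, hf, hfc, hfeq⟩ := exists_contDiff_cylinder_eq_ridge (L := L)
    (fun l => c l * Real.exp (-(∑ e, (m l e : ℝ) * ((m l e : ℝ) + 2) / 2) * s)) g m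
  refine ⟨f, hf, hfc, fun V => ?_⟩
  rw [hfeq V, transition_ridge_beta_zero L κ₀ hreal₀ c g m s V]

end Summit.QuantumFields.YangMills.Theorems.ColdStartUniversality

end
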